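import Summits.BirchSwinnertonDyer.BirchSwinnertonDyer.Theorems.KimAtThreeStubPropagatedLocalIndex
import Summits.BirchSwinnertonDyer.Rank1Residual.GaloisImage.KuriharaTowerPackaging
import HarnessLib

/-!
# The Poitou–Tate pair count at the empty level WITHOUT a port:
# `#H¹_{𝓕_can}(ℚ, E[3^{i+1}]) = 3^{i+1} · #H¹_{𝓕_can^*}(ℚ, E[3^{i+1}]^D)` for every `E/ℚ`, every depth
# (item stmt-BirchSwinnertonDyer-19561 `KimAtThreeKolyvagin.StubAtEmptyLevelThree`, helper; seat
# bsd-addord-w2-c5 gen 4; route-independent module — no Theses import)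

n1011's `DeepLedger.natCard_selmerGroup_propagated_eq` (Mazur–Rubin Prop. 2.3.5 for the pair
`𝓚 ≤ 𝓕_can`) takes ONE local datum at the place `v_p`: the `Λ`-clauses of the Kato–Kurihara port
(`Λ` onto `ℤ/p^{k+1}` on `𝓕_can(v_p)` with kernel `𝓚(v_p)`), used only for the COUNT
`#𝓕_can(v_p) = p^{k+1} · #𝓚(v_p)`.  This file
* restates that theorem with the bare count as hypothesis
  (**`natCard_selmerGroup_propagated_eq_of_localIndex`**, proof = n1011's verbatim), and
* discharges it at `p = 3` by this seat's local index
  `KimAtThreeStubLocalIndex.natCard_propagatedSelmerStructure_three_of_mem` (p502450), Tate's local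
  Euler–Poincaré characteristic (n1011-p04 `EP.forall_localEulerPoincareCharacteristic_adicCompletion`)
  and n1011's admissible set `TowerPackage.towerAdmissible`:
  **`natCard_selmerGroup_propagated_three_eq`** — for every elliptic `W/ℚ`, every depth `i` and every
  Poitou–Tate family at the modulus `3^{i+1}` (IsPerfect, SumLocalTermEqZero, SelmerComplement),
  `#H¹_{𝓕_can}(ℚ, E[3^i·3]) = 3^{i+1} · #H¹_{𝓕_can^*}`.  No tower / reduction / image hypothesis.
This is the binder `hPTcount` of w2-c5 gen 3's `stubAtEmptyLevelThree_pinned_of_parts` as a theorem;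
the sibling `KimAtThreeStubPinnedOfPub` feeds it in.
References: [MazurRubin2004] Prop. 2.3.5; [MilneADT2006] I Thm. 2.8, Thm. 4.10; [Kim2022StructureSelmer] Prop. 3.12.
-/

set_option autoImplicit false
-- the Theorems namespace of a single-conjunct summit repeats the summit name by design (D-0017)
set_option linter.dupNamespace false

noncomputable section

open scoped Classical NumberField ContRepresentation
open Function Field NumberField IsDedekindDomain WeierstrassCurve Literature.NumberTheory.EllipticCurves
  Literature.NumberTheory.GaloisRepresentations Literature.NumberTheory.GaloisRepresentations.DiscreteGaloisModule
  Literature.NumberTheory.GaloisCohomology Literature.NumberTheory.GaloisCohomology.KolyvaginDatum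
  Summit.BirchSwinnertonDyer.Rank1Residual.GaloisImage

namespace Summit.BirchSwinnertonDyer.BirchSwinnertonDyer.Theorems.KimAtThreeStubLocalIndex


/-! ### §1. The Poitou–Tate pair count at `∅` from the bare local index -/

section PairCount

variable (W : WeierstrassCurve ℚ) [W.IsElliptic] (p : ℕ) [hp : Fact p.Prime] (k : ℕ)

/-- **`#H¹_{𝓕_can}(ℚ, E[p^{k+1}]) = p^{k+1} · #H¹_{𝓕_can^*}(ℚ, E[p^{k+1}]^D)`** (`p` odd) — n1011's
`DeepLedger.natCard_selmerGroup_propagated_eq` VERBATIM except that the `Λ`-clauses of the dictionary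
(`Λ` onto `ℤ/p^{k+1}` on `𝓕_can(v_p)` with kernel `𝓚(v_p)`) are replaced by what they were used for,
the local index `hidx : #𝓕_can(v_p) = p^{k+1} · #𝓚(v_p)`.  Proof = n1011's: p13's pair count for
`𝓚 ≤ 𝓕_can`, the self-duality count `#H¹_𝓚 = #H¹_{𝓚^*}`, `𝓕_can,v = 𝓚_v` off `v_p`, `H¹ = 0` at `∞`.
[cite: MazurRubin2004, Prop. 2.3.5] [cite: Sakamoto2024, Def. 3.9 (p. 924)] -/
theorem natCard_selmerGroup_propagated_eq_of_localIndex (hp2 : p ≠ 2) {v₀ : HeightOneSpectrum (𝓞 ℚ)}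
    (hv₀ : ((p : ℕ) : 𝓞 ℚ) ∈ v₀.asIdeal)
    [Finite (geomTorsion W ((p : ℤ) ^ k * (p : ℤ)))]
    (hidx : Nat.card (propagatedSelmerStructure W p k (Sum.inr v₀)) =
      p ^ (k + 1) * Nat.card (W.kummerSelmerStructure ((p : ℤ) ^ k * (p : ℤ)) (Sum.inr v₀)))
    (inv : LocalInvariants ℚ (p ^ (k + 1))) (hperf : inv.IsPerfect) (hsum : inv.SumLocalTermEqZero)
    (hcompl : inv.SelmerComplement)
    (hinj : ∀ v : HeightOneSpectrum (𝓞 ℚ), Injective (inv (Sum.inr v)))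
    (hEP : ∀ v : HeightOneSpectrum (𝓞 ℚ), localEulerPoincareCharacteristic (v.adicCompletion ℚ))
    (T : Finset (HeightOneSpectrum (𝓞 ℚ))) (hv₀T : v₀ ∈ T)
    (hT : ∀ v : HeightOneSpectrum (𝓞 ℚ), v ∉ T →
      (((p ^ (k + 1) : ℕ) : ℕ) : 𝓞 ℚ) ∉ v.asIdeal ∧
        GaloisRep.IsUnramifiedAt v (W.torsionGaloisModule ((p : ℤ) ^ k * (p : ℤ))))
    (h𝓕T : (propagatedSelmerStructure W p k).IsUnramifiedOutside (finSupport T))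
    (h𝓚T : (W.kummerSelmerStructure ((p : ℤ) ^ k * (p : ℤ))).IsUnramifiedOutside (finSupport T))
    [Finite (W.kummerSelmerStructure ((p : ℤ) ^ k * (p : ℤ))).selmerGroup] :
    Nat.card (propagatedSelmerStructure W p k).selmerGroup =
      p ^ (k + 1) * Nat.card (inv.dualSelmerStructure (W.torsionGaloisModule ((p : ℤ) ^ k * (p : ℤ)))
        (propagatedSelmerStructure W p k)).selmerGroup := by
  haveI : NeZero (p ^ (k + 1)) := ⟨pow_ne_zero _ hp.out.ne_zero⟩
  have hle : W.kummerSelmerStructure ((p : ℤ) ^ k * (p : ℤ)) ≤ propagatedSelmerStructure W p k :=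
    fun v => kummerSelmerStructure_le_propagatedSelmerStructure W p v k
  have hM : ∀ m : geomTorsion W ((p : ℤ) ^ k * (p : ℤ)), (p ^ (k + 1)) • m = 0 := fun T => by
    have h := W.natAbs_nsmul_geomTorsion T
    rwa [show ((p : ℤ) ^ k * (p : ℤ)).natAbs = p ^ (k + 1) by
      rw [Int.natAbs_mul, Int.natAbs_pow, Int.natAbs_natCast, pow_succ]] at h
  -- p13's pair count for `𝓚 ≤ 𝓕_can`
  have hpair := card_selmerGroup_pair (W.torsionGaloisModule ((p : ℤ) ^ k * (p : ℤ))) T inv hperf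
    hsum hcompl hM hT hle h𝓚T h𝓕T (fun w => DeepLedger.apply_inl_eq_of_odd W p k hp2 _ _ w)
  -- the self-duality count `#H¹_𝓚 = #H¹_{𝓚^*}`
  have hKSD := DeepLedger.natCard_selmerGroup_kummer_eq_dual_of_eq W ((p : ℤ) ^ k * (p : ℤ))
    (p ^ (k + 1)) (by push_cast; ring) (hp.out.isPrimePow.pow (Nat.succ_ne_zero k))
    ((hp.out.odd_of_ne_two hp2).pow) inv hinj hEP
  -- local terms: equal off `v₀`, index `p^{k+1}` at `v₀`
  haveI : ∀ v : HeightOneSpectrum (𝓞 ℚ), Finite (galoisCohomology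
      ((W.torsionGaloisModule ((p : ℤ) ^ k * (p : ℤ))).toLocal (Sum.inr v)) 1) := fun v =>
    DeepLedger.finite_galoisCohomology_toLocal_inr _ v
  have hloc : ∀ v ∈ T, v ≠ v₀ →
      propagatedSelmerStructure W p k (Sum.inr v) =
        W.kummerSelmerStructure ((p : ℤ) ^ k * (p : ℤ)) (Sum.inr v) := by
    intro v _ hv
    have hpv : ((p : ℕ) : 𝓞 ℚ) ∉ v.asIdeal := fun h' =>
      hv (heightOneSpectrum_eq_of_natCast_mem hp.out h' hv₀)
    exact propagatedSelmerStructure_inr_eq_kummerSelmerStructure W p k hpv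
  have hprod : ∏ v ∈ T, Nat.card (propagatedSelmerStructure W p k (Sum.inr v)) =
      p ^ (k + 1) * ∏ v ∈ T, Nat.card (W.kummerSelmerStructure ((p : ℤ) ^ k * (p : ℤ)) (Sum.inr v)) := by
    rw [← Finset.mul_prod_erase T _ hv₀T, ← Finset.mul_prod_erase T _ hv₀T, hidx, mul_assoc]
    congr 2
    exact Finset.prod_congr rfl fun v hv => by
      rw [hloc v (Finset.mem_of_mem_erase hv) (Finset.ne_of_mem_erase hv)]
  -- cancel
  have hne1 : Nat.card (W.kummerSelmerStructure ((p : ℤ) ^ k * (p : ℤ))).selmerGroup ≠ 0 :=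
    Nat.card_pos.ne'
  have hne2 : ∏ v ∈ T, Nat.card (W.kummerSelmerStructure ((p : ℤ) ^ k * (p : ℤ)) (Sum.inr v)) ≠ 0 :=
    Finset.prod_ne_zero_iff.2 fun v _ => Nat.card_pos.ne'
  rw [hprod, ← hKSD] at hpair
  have h := hpair
  have : Nat.card (propagatedSelmerStructure W p k).selmerGroup *
      (Nat.card (W.kummerSelmerStructure ((p : ℤ) ^ k * (p : ℤ))).selmerGroup *
        ∏ v ∈ T, Nat.card (W.kummerSelmerStructure ((p : ℤ) ^ k * (p : ℤ)) (Sum.inr v))) =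
      (p ^ (k + 1) * Nat.card (inv.dualSelmerStructure (W.torsionGaloisModule ((p : ℤ) ^ k * (p : ℤ)))
        (propagatedSelmerStructure W p k)).selmerGroup) *
      (Nat.card (W.kummerSelmerStructure ((p : ℤ) ^ k * (p : ℤ))).selmerGroup *
        ∏ v ∈ T, Nat.card (W.kummerSelmerStructure ((p : ℤ) ^ k * (p : ℤ)) (Sum.inr v))) := by
    rw [← mul_assoc, h]
    ring
  exact Nat.eq_of_mul_eq_mul_right (Nat.pos_of_ne_zero (mul_ne_zero hne1 hne2)) this

end PairCount

/-- **The Poitou–Tate pair count at `∅` for `p = 3`, NO port: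
`#H¹_{𝓕_can}(ℚ, E[3^{i+1}]) = 3^{i+1} · #H¹_{𝓕_can^*}(ℚ, E[3^{i+1}]^D)`** for every elliptic curve
`E/ℚ`, every depth `i` and every Poitou–Tate family `inv` at the modulus `3^{i+1}` with its
properties (IsPerfect, SumLocalTermEqZero, SelmerComplement) — the core-rank-one Euler
characteristic of Mazur–Rubin Prop. 2.3.5 / Wiles.  Inputs: the local index at `3` (this seat's
`natCard_propagatedSelmerStructure_three_of_mem`), Tate's local Euler–Poincaré characteristic
(`EP.forall_localEulerPoincareCharacteristic_adicCompletion`), n1011's admissible set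
`TowerPackage.towerAdmissible`.  This is the binder `hPTcount` of w2-c5 gen 3's
`stubAtEmptyLevelThree_pinned_of_parts`, discharged (its tower-surjectivity and
`UnramifiedOrthogonal` binders are not needed).
[cite: MazurRubin2004, Prop. 2.3.5] [cite: MilneADT2006, Ch. I, Thm. 2.8 and Thm. 4.10] -/
theorem natCard_selmerGroup_propagated_three_eq (W : WeierstrassCurve ℚ) [W.IsElliptic] (i : ℕ)
    [Finite (geomTorsion W (((3 : ℕ) : ℤ) ^ i * ((3 : ℕ) : ℤ)))]
    (inv : LocalInvariants ℚ (3 ^ (i + 1))) (hperf : inv.IsPerfect) (hsum : inv.SumLocalTermEqZero)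
    (hcompl : inv.SelmerComplement) :
    haveI : Fact (Nat.Prime 3) := ⟨Nat.prime_three⟩
    Nat.card (propagatedSelmerStructure W 3 i).selmerGroup =
      3 ^ (i + 1) * Nat.card (inv.dualSelmerStructure
        (W.torsionGaloisModule (((3 : ℕ) : ℤ) ^ i * ((3 : ℕ) : ℤ))) (propagatedSelmerStructure W 3 i)).selmerGroup := by
  haveI : Fact (Nat.Prime 3) := ⟨Nat.prime_three⟩
  -- the place above `3`
  let v₃ : HeightOneSpectrum (𝓞 ℚ) :=
    (Rat.HeightOneSpectrum.primesEquiv (R := 𝓞 ℚ)).symm ⟨3, Nat.prime_three⟩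
  have hgen3 : Rat.HeightOneSpectrum.natGenerator v₃ = 3 :=
    congrArg Subtype.val
      ((Rat.HeightOneSpectrum.primesEquiv (R := 𝓞 ℚ)).apply_symm_apply ⟨3, Nat.prime_three⟩)
  have hv₃ : ((3 : ℕ) : 𝓞 ℚ) ∈ v₃.asIdeal := by
    have h := Rat.HeightOneSpectrum.natCast_natGenerator_mem v₃
    rwa [hgen3] at h
  -- the admissible set `T = {v ∣ 3} ∪ {bad}`
  obtain ⟨T, h3T, -, -, hT, h𝓕T, h𝓚T, hfinT, hfinS⟩ := TowerPackage.towerAdmissible W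
  haveI := hfinT i
  haveI := hfinS i
  exact natCard_selmerGroup_propagated_eq_of_localIndex W 3 i (by norm_num) hv₃
    (natCard_propagatedSelmerStructure_three_of_mem W v₃ hv₃ i) inv hperf hsum hcompl
    (fun v => (hperf v).1.injective) (EP.forall_localEulerPoincareCharacteristic_adicCompletion ℚ)
    T (h3T v₃ hv₃) (hT i) (h𝓕T i) (h𝓚T i)

end Summit.BirchSwinnertonDyer.BirchSwinnertonDyer.Theorems.KimAtThreeStubLocalIndex

end
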